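import Summits.RiemannHypothesis.RiemannHypothesis.Theses.GroundBarta
import Summits.RiemannHypothesis.RiemannHypothesis.Theses.WeilParity
import Summits.RiemannHypothesis.RiemannHypothesis.Theorems.WeilParityEvenWinsBeyondArchFrontier63
import Summits.RiemannHypothesis.RiemannHypothesis.Theorems.GroundBartaGroundBartaFloor
import Summits.RiemannHypothesis.RiemannHypothesis.Theorems.GroundBartaOddNegativityOffLine
import HarnessLib

/-!
# RiemannHypothesis / GroundBarta — the route's RESIDUAL after the proved rungs

Helper file (`--supports` rung 3, stmt-RiemannHypothesis-18390), RH-free, Mathlib + proved tree files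
only, no definitions.

`riemannHypothesis_of_polarPerronFrobenius_of_noParityCrossing`: with the rung `GroundBartaFloor`
(rung 2, PROVED: `GroundBartaFloor.GroundBartaFloor_of`) and the detector `OddNegativityOffLine`
(PROVED: `oddNegativityOffLine_proof`) discharged in the deciding theorem `GroundBarta.closes`, and
rung 4 `EvenWinsBeyondArch` transported from route WeilParity's single open crux `NoParityCrossing`
(`GroundBarta.evenWinsBeyondArch_of_noParityCrossing`, landed in
`Theorems/WeilParityEvenWinsBeyondArchFrontier63.lean`), the Riemann Hypothesis follows from exactly two
open statements: `GroundBarta.PolarPerronFrobenius` (rung 3 — Perron–Frobenius survives the polar term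
beyond every height; = stub S1 `stub_evenConeDense_cofinal`, whose matrix holds unconditionally at every
window `0 < a ≤ 1/10` by `PolarPerronFrobenius.sw_polarMatrix_small`) and `WeilParity.NoParityCrossing`
(no parity tie beyond `(log 3)/2`; equivalently beyond `63/100`).
Prover B, speedrun unit `sr-gb-rung-b`.
-/

set_option linter.dupNamespace false

noncomputable section

namespace Summit.RiemannHypothesis.RiemannHypothesis.Theorems.GroundBarta

open Summit.RiemannHypothesis.RiemannHypothesis.Theses

/-- **Residual of route GroundBarta**: `PolarPerronFrobenius → NoParityCrossing → RH`, the proved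
rungs (`GroundBartaFloor`, `OddNegativityOffLine`, WeilParity's one-prime window and split glue) being
discharged. [folklore] -/
theorem riemannHypothesis_of_polarPerronFrobenius_of_noParityCrossing
    (hPF : GroundBarta.PolarPerronFrobenius) (hNPC : WeilParity.NoParityCrossing) :
    _root_.Summit.RiemannHypothesis :=
  GroundBarta.closes GroundBartaFloor.GroundBartaFloor_of hPF (evenWinsBeyondArch_of_noParityCrossing hNPC)
    oddNegativityOffLine_proof

end Summit.RiemannHypothesis.RiemannHypothesis.Theorems.GroundBarta

end
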